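import Summits.AtomisticToContinuum.FouriersLaw.Theorems.HonestZwanzigFeshbachIdentitiesSiteEnergy

/-!
# `HonestZwanzig.FeshbachIdentities`, site energies part 2: Dynkin's identity for `e_x`

Support file for item `stmt-AtomisticToContinuum-12697` (`HonestZwanzig.FeshbachIdentities`). For the pinned anharmonic
chain `pinnedChain ω₂ lam β γ` (`ω₂ > 0`, `lam ≥ 0`, `β, γ > 0`), `N ≥ 2`, equal bath temperatures `T > 0`, the CONSTRUCTED
kernels `P_t = transitionKernel N T T t` and the symmetrically split site energies `e_x` (abstract family `e` with its
defining equation `he`, as in part 1):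

* `pinnedChain_abs_generator_truncSplitSite_sub_le` — the truncation error `|L(e_x χ(H/R)) - χ(H/R) L e_x| ≤ (A/R)(1+H)²`
  (`χ = smoothCutoff`; `generator_mul_smoothCutoff_hamiltonian`, `∂_{p_b} e_x = [b = x] p_b`, `0 ≤ e_x ≤ (N+2)H`);
* `pinnedChain_splitSite_dynkin` — **Dynkin's identity** `P_r e_x(z) - e_x(z) = ∫₀ʳ P_s(L e_x)(z) ds` for all `r ≥ 0`, `z`,
  by the truncation engine `pinnedChain_dynkin_of_truncation` of `…SiteEnergyDynkinTruncation`, exactly as for the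
  bath-site energy in `…SiteEnergyDynkin`.
-/

noncomputable section

open MeasureTheory ProbabilityTheory Filter Topology Set Function
open scoped NNReal ENNReal
open Literature.MathematicalPhysics.KineticTheory.HeatConduction
open Literature.MathematicalPhysics.KineticTheory Literature.Probability.Process OscillatorChain
open Summit.AtomisticToContinuum.FouriersLaw.Theorems.SubdiffusiveBondHeat

namespace Summit.AtomisticToContinuum.FouriersLaw.Theorems.HonestZwanzig

variable {N : ℕ}

section SplitSiteDynkin

variable {ω₂ lam β γ : ℝ} (e : Fin N → PhaseSpace N → ℝ)
  (he : ∀ x z, e x z = z.2 x ^ 2 / 2 + (pinnedChain ω₂ lam β γ).U (z.1 x) +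
    ∑ j : Fin N, ((if j.val = x.val + 1 then (pinnedChain ω₂ lam β γ).V (z.1 j - z.1 x) / 2 else 0) +
      (if x.val = j.val + 1 then (pinnedChain ω₂ lam β γ).V (z.1 x - z.1 j) / 2 else 0)))
include he

/-! ### Dynkin's identity for `e_x` by truncation -/

/-- **The truncation error**: for `ω₂ > 0`, `lam, β, γ ≥ 0`, `N ≥ 2`, `T ≥ 0` there is `A ≥ 0` with
`|L(e_x χ(H/R)) - χ(H/R) L e_x| ≤ (A/R)(1 + H)²` on phase space for all `R ≥ 1` (`χ = smoothCutoff`): the difference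
is `e_x Lχ_R + Γ(e_x, χ_R)` (`generator_mul_smoothCutoff_hamiltonian`), with `∂_{p_b} e_x = [b = x] p_b`,
`χ', χ''` bounded, `0 ≤ e_x ≤ (N+2)H`, `p_0² + p_{N-1}² ≤ 4H`. [folklore] -/
theorem pinnedChain_abs_generator_truncSplitSite_sub_le (hω : 0 < ω₂) (hl : 0 ≤ lam) (hβ : 0 ≤ β) (hγ : 0 ≤ γ)
    (hN : 2 ≤ N) {T : ℝ} (hT : 0 ≤ T) (x : Fin N) :
    ∃ A : ℝ, 0 ≤ A ∧ ∀ R : ℝ, 1 ≤ R → ∀ z : PhaseSpace N,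
      |(pinnedChain ω₂ lam β γ).generator N T T (fun y => e x y *
            smoothCutoff ((pinnedChain ω₂ lam β γ).hamiltonian N y / R)) z -
          smoothCutoff ((pinnedChain ω₂ lam β γ).hamiltonian N z / R) *
            (pinnedChain ω₂ lam β γ).generator N T T (e x) z| ≤
        A / R * (1 + (pinnedChain ω₂ lam β γ).hamiltonian N z) ^ 2 := by
  have hN0 : 0 < N := by omega
  have hN1 : N - 1 < N := Nat.sub_lt hN0 one_pos
  obtain ⟨M₁, hM₁0, hM₁⟩ := exists_bound_deriv_smoothCutoff
  obtain ⟨M₂, hM₂0, hM₂⟩ := exists_bound_deriv_deriv_smoothCutoff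
  refine ⟨γ * ((N : ℝ) + 2) * (10 * M₁ * T + 4 * M₁ + 4 * M₂ * T), by positivity, fun R hR z => ?_⟩
  have hR0 : 0 < R := lt_of_lt_of_le one_pos hR
  set P := pinnedChain ω₂ lam β γ with hP
  have hTγ : 0 ≤ P.γ * T := mul_nonneg hγ hT
  have hU2 : ContDiff ℝ 2 P.U := pinnedChain_contDiff_U ω₂ lam β γ
  have hV2 : ContDiff ℝ 2 P.V := pinnedChain_contDiff_V ω₂ lam β γ
  have he2 : ContDiff ℝ 2 (e x) := by
    rw [splitSite_eq e he x, splitSiteEnergy_eq_energyProfile _ x]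
    refine (ContDiff.sum fun k _ => contDiff_const.mul ?_).add (ContDiff.sum fun k _ => ContDiff.sum fun l _ => ?_)
    · exact (((contDiff_apply ℝ ℝ k).comp contDiff_snd).pow 2 |>.div_const 2).add
        (hU2.comp ((contDiff_apply ℝ ℝ k).comp contDiff_fst))
    · by_cases hlk : l.val = k.val + 1
      · simp only [hlk, if_true]
        exact contDiff_const.mul (hV2.comp (((contDiff_apply ℝ ℝ l).comp contDiff_fst).sub
          ((contDiff_apply ℝ ℝ k).comp contDiff_fst)))
      · simp only [hlk, if_false]; exact contDiff_const
  have hγ' : P.γ = γ := rfl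
  rw [generator_mul_smoothCutoff_hamiltonian hU2 hV2 hN0 hTγ hTγ he2 R z, partialP_splitSite e he, partialP_splitSite e he,
    hγ', add_sub_cancel_left]
  -- the elementary bounds
  obtain ⟨-, -, hbd, -⟩ := pinnedChain_splitSite_nice e he hω hl hβ x
  obtain ⟨hE0, hEH⟩ := hbd z
  have hH0 : 0 ≤ P.hamiltonian N z := pinnedChain_hamiltonian_nonneg hω.le hl hβ γ N z
  have hne : (⟨N - 1, hN1⟩ : Fin N) ≠ ⟨0, hN0⟩ := by
    intro h; have := congrArg Fin.val h; simp only at this; omega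
  have habH : z.2 ⟨0, hN0⟩ ^ 2 + z.2 ⟨N - 1, hN1⟩ ^ 2 ≤ 4 * P.hamiltonian N z := by
    have := pinnedChain_sq_add_sq_le_hamiltonian hω.le hl hβ γ N z hne.symm
    linarith
  have hχ₁b := hM₁ (P.hamiltonian N z / R)
  have hχ₂b := hM₂ (P.hamiltonian N z / R)
  have hδ0 : ∀ c : Prop, ∀ _ : Decidable c, |z.2 ⟨0, hN0⟩ * ((if c then (1 : ℝ) else 0) * z.2 ⟨0, hN0⟩)| ≤
      z.2 ⟨0, hN0⟩ ^ 2 := by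
    intro c _; split_ifs
    · rw [one_mul, ← sq, abs_of_nonneg (sq_nonneg _)]
    · rw [zero_mul, mul_zero, abs_zero]; exact sq_nonneg _
  have hδ1 : ∀ c : Prop, ∀ _ : Decidable c, |z.2 ⟨N - 1, hN1⟩ * ((if c then (1 : ℝ) else 0) * z.2 ⟨N - 1, hN1⟩)| ≤
      z.2 ⟨N - 1, hN1⟩ ^ 2 := by
    intro c _; split_ifs
    · rw [one_mul, ← sq, abs_of_nonneg (sq_nonneg _)]
    · rw [zero_mul, mul_zero, abs_zero]; exact sq_nonneg _
  have hd0 := hδ0 ((⟨0, hN0⟩ : Fin N) = x) inferInstance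
  have hd1 := hδ1 ((⟨N - 1, hN1⟩ : Fin N) = x) inferInstance
  -- make the atoms opaque
  generalize ((if (⟨0, hN0⟩ : Fin N) = x then (1 : ℝ) else 0) * z.2 ⟨0, hN0⟩) = d0 at hd0 ⊢
  generalize ((if (⟨N - 1, hN1⟩ : Fin N) = x then (1 : ℝ) else 0) * z.2 ⟨N - 1, hN1⟩) = d1 at hd1 ⊢
  generalize deriv smoothCutoff (P.hamiltonian N z / R) = χ₁ at hχ₁b ⊢
  generalize deriv (deriv smoothCutoff) (P.hamiltonian N z / R) = χ₂ at hχ₂b ⊢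
  generalize e x z = E at hE0 hEH ⊢
  generalize P.hamiltonian N z = Hx at hH0 habH hEH ⊢
  generalize z.2 ⟨0, hN0⟩ = p at habH hd0 ⊢
  generalize z.2 ⟨N - 1, hN1⟩ = q at habH hd1 ⊢
  have ha0 : 0 ≤ p ^ 2 := sq_nonneg _
  have hb0 : 0 ≤ q ^ 2 := sq_nonneg _
  -- everything carries a factor `γ/R`
  have key : E * (γ * (χ₁ / R * (T + T - p ^ 2 - q ^ 2) + χ₂ / R ^ 2 * (T * p ^ 2 + T * q ^ 2))) +
      χ₁ / R * (2 * γ * T * p * d0 + 2 * γ * T * q * d1) =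
      γ / R * (E * (χ₁ * (2 * T - p ^ 2 - q ^ 2) + χ₂ * T * (p ^ 2 + q ^ 2) / R) + χ₁ * (2 * T * (p * d0 + q * d1))) := by
    ring
  have hin : |E * (χ₁ * (2 * T - p ^ 2 - q ^ 2) + χ₂ * T * (p ^ 2 + q ^ 2) / R) + χ₁ * (2 * T * (p * d0 + q * d1))| ≤
      E * (M₁ * (2 * T + p ^ 2 + q ^ 2) + M₂ * T * (p ^ 2 + q ^ 2)) + M₁ * (2 * T * (p ^ 2 + q ^ 2)) := by
    have h1 : |χ₁ * (2 * T - p ^ 2 - q ^ 2)| ≤ M₁ * (2 * T + p ^ 2 + q ^ 2) := by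
      rw [abs_mul]
      refine mul_le_mul hχ₁b ?_ (abs_nonneg _) hM₁0
      rw [abs_le]; constructor <;> linarith
    have h2 : |χ₂ * T * (p ^ 2 + q ^ 2) / R| ≤ M₂ * T * (p ^ 2 + q ^ 2) := by
      rw [abs_div, abs_mul, abs_mul, abs_of_nonneg hT, abs_of_nonneg (add_nonneg ha0 hb0), abs_of_pos hR0]
      calc |χ₂| * T * (p ^ 2 + q ^ 2) / R ≤ |χ₂| * T * (p ^ 2 + q ^ 2) / 1 :=
            div_le_div_of_nonneg_left (by positivity) one_pos hR
        _ ≤ M₂ * T * (p ^ 2 + q ^ 2) := by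
            rw [div_one]
            exact mul_le_mul_of_nonneg_right (mul_le_mul_of_nonneg_right hχ₂b hT) (add_nonneg ha0 hb0)
    have h3 : |χ₁ * (2 * T * (p * d0 + q * d1))| ≤ M₁ * (2 * T * (p ^ 2 + q ^ 2)) := by
      rw [abs_mul]
      refine mul_le_mul hχ₁b ?_ (abs_nonneg _) hM₁0
      rw [abs_mul, abs_of_nonneg (by positivity : (0:ℝ) ≤ 2 * T)]
      refine mul_le_mul_of_nonneg_left ((abs_add_le _ _).trans (add_le_add hd0 hd1)) (by positivity)
    calc |E * (χ₁ * (2 * T - p ^ 2 - q ^ 2) + χ₂ * T * (p ^ 2 + q ^ 2) / R) + χ₁ * (2 * T * (p * d0 + q * d1))|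
        ≤ |E * (χ₁ * (2 * T - p ^ 2 - q ^ 2) + χ₂ * T * (p ^ 2 + q ^ 2) / R)| + |χ₁ * (2 * T * (p * d0 + q * d1))| :=
          abs_add_le _ _
      _ = E * |χ₁ * (2 * T - p ^ 2 - q ^ 2) + χ₂ * T * (p ^ 2 + q ^ 2) / R| + |χ₁ * (2 * T * (p * d0 + q * d1))| := by
          rw [abs_mul, abs_of_nonneg hE0]
      _ ≤ E * (|χ₁ * (2 * T - p ^ 2 - q ^ 2)| + |χ₂ * T * (p ^ 2 + q ^ 2) / R|) + |χ₁ * (2 * T * (p * d0 + q * d1))| := by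
          gcongr
          exact abs_add_le _ _
      _ ≤ E * (M₁ * (2 * T + p ^ 2 + q ^ 2) + M₂ * T * (p ^ 2 + q ^ 2)) + M₁ * (2 * T * (p ^ 2 + q ^ 2)) := by
          gcongr
  have hpoly : E * (M₁ * (2 * T + p ^ 2 + q ^ 2) + M₂ * T * (p ^ 2 + q ^ 2)) + M₁ * (2 * T * (p ^ 2 + q ^ 2)) ≤
      ((N : ℝ) + 2) * (10 * M₁ * T + 4 * M₁ + 4 * M₂ * T) * (1 + Hx) ^ 2 := by
    have hN0' : (0 : ℝ) ≤ (N : ℝ) := Nat.cast_nonneg N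
    have hN2 : (1 : ℝ) ≤ (N : ℝ) + 2 := by linarith
    have hM₁T : 0 ≤ M₁ * T := mul_nonneg hM₁0 hT
    have hM₂T : 0 ≤ M₂ * T := mul_nonneg hM₂0 hT
    have hS : 2 * T + p ^ 2 + q ^ 2 ≤ 2 * T + 4 * Hx := by linarith
    have s1 : E * (M₁ * (2 * T + p ^ 2 + q ^ 2) + M₂ * T * (p ^ 2 + q ^ 2)) ≤
        (((N : ℝ) + 2) * Hx) * (M₁ * (2 * T + 4 * Hx) + M₂ * T * (4 * Hx)) :=
      mul_le_mul hEH (add_le_add (mul_le_mul_of_nonneg_left hS hM₁0) (mul_le_mul_of_nonneg_left habH hM₂T))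
        (by positivity) (by positivity)
    have s2 : M₁ * (2 * T * (p ^ 2 + q ^ 2)) ≤ M₁ * (2 * T * (4 * Hx)) :=
      mul_le_mul_of_nonneg_left (mul_le_mul_of_nonneg_left habH (by positivity)) hM₁0
    have s3 : M₁ * (2 * T * (4 * Hx)) ≤ ((N : ℝ) + 2) * (M₁ * (2 * T * (4 * Hx))) :=
      le_mul_of_one_le_left (by positivity) hN2
    have s4 : Hx * (M₁ * (2 * T + 4 * Hx) + M₂ * T * (4 * Hx)) + M₁ * (2 * T * (4 * Hx)) ≤
        (10 * M₁ * T + 4 * M₁ + 4 * M₂ * T) * (1 + Hx) ^ 2 := by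
      have hex : (10 * M₁ * T + 4 * M₁ + 4 * M₂ * T) * (1 + Hx) ^ 2 -
          (Hx * (M₁ * (2 * T + 4 * Hx) + M₂ * T * (4 * Hx)) + M₁ * (2 * T * (4 * Hx))) =
          10 * (M₁ * T) + 10 * (M₁ * T * Hx) + 10 * (M₁ * T * Hx * Hx) + 4 * M₁ + 8 * (M₁ * Hx) +
            4 * (M₂ * T) + 8 * (M₂ * T * Hx) := by
        ring
      have h1 := mul_nonneg hM₁T hH0
      have h2 := mul_nonneg h1 hH0
      have h3 := mul_nonneg hM₁0 hH0
      have h4 := mul_nonneg hM₂T hH0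
      linarith
    calc E * (M₁ * (2 * T + p ^ 2 + q ^ 2) + M₂ * T * (p ^ 2 + q ^ 2)) + M₁ * (2 * T * (p ^ 2 + q ^ 2))
        ≤ ((N : ℝ) + 2) * Hx * (M₁ * (2 * T + 4 * Hx) + M₂ * T * (4 * Hx)) +
            ((N : ℝ) + 2) * (M₁ * (2 * T * (4 * Hx))) := add_le_add s1 (s2.trans s3)
      _ = ((N : ℝ) + 2) * (Hx * (M₁ * (2 * T + 4 * Hx) + M₂ * T * (4 * Hx)) + M₁ * (2 * T * (4 * Hx))) := by
          ring
      _ ≤ ((N : ℝ) + 2) * ((10 * M₁ * T + 4 * M₁ + 4 * M₂ * T) * (1 + Hx) ^ 2) :=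
          mul_le_mul_of_nonneg_left s4 (by positivity)
      _ = ((N : ℝ) + 2) * (10 * M₁ * T + 4 * M₁ + 4 * M₂ * T) * (1 + Hx) ^ 2 := by ring
  rw [key, abs_mul, abs_div, abs_of_nonneg hγ, abs_of_pos hR0]
  calc γ / R * |E * (χ₁ * (2 * T - p ^ 2 - q ^ 2) + χ₂ * T * (p ^ 2 + q ^ 2) / R) + χ₁ * (2 * T * (p * d0 + q * d1))|
      ≤ γ / R * (E * (M₁ * (2 * T + p ^ 2 + q ^ 2) + M₂ * T * (p ^ 2 + q ^ 2)) + M₁ * (2 * T * (p ^ 2 + q ^ 2))) :=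
        mul_le_mul_of_nonneg_left hin (div_nonneg hγ hR0.le)
    _ ≤ γ / R * (((N : ℝ) + 2) * (10 * M₁ * T + 4 * M₁ + 4 * M₂ * T) * (1 + Hx) ^ 2) :=
        mul_le_mul_of_nonneg_left hpoly (div_nonneg hγ hR0.le)
    _ = γ * ((N : ℝ) + 2) * (10 * M₁ * T + 4 * M₁ + 4 * M₂ * T) / R * (1 + Hx) ^ 2 := by ring

/-- **Dynkin's identity for the split site energy.** For `pinnedChain ω₂ lam β γ` (`ω₂ > 0`, `lam ≥ 0`, `β, γ > 0`),
`N ≥ 2`, equal bath temperatures `T > 0`, the constructed kernels `P_t = transitionKernel N T T t` and every site `x`: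
`P_r e_x(z) - e_x(z) = ∫₀ʳ P_s(L e_x)(z) ds` for all `r ≥ 0`, `z` — Dynkin for the polynomially growing observable
`e_x` from the `C²_c` case by the truncations `e_x χ(H/R)` (`pinnedChain_dynkin_of_truncation`), all errors being
`O((1+H)²/R) = O(e^{H/(2T)}/R)`. [cite: CuneoEckmannHairerReyBellet2018, §3 eq. (3.2)–(3.4)] -/
theorem pinnedChain_splitSite_dynkin (hω : 0 < ω₂) (hl : 0 ≤ lam) (hβ : 0 < β) (hγ : 0 < γ) (hN : 2 ≤ N) {T : ℝ}
    (hT : 0 < T) (x : Fin N) (r : ℝ≥0) (z : PhaseSpace N) :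
    (∫ y, e x y ∂((pinnedChain ω₂ lam β γ).transitionKernel N T T r z)) - e x z =
      ∫ s in (0 : ℝ)..(r : ℝ), ∫ y, (pinnedChain ω₂ lam β γ).generator N T T (e x) y
        ∂((pinnedChain ω₂ lam β γ).transitionKernel N T T s.toNNReal z) := by
  have hN0 : 0 < N := by omega
  set P := pinnedChain ω₂ lam β γ with hP
  obtain ⟨A, hA0, hA⟩ := pinnedChain_abs_generator_truncSplitSite_sub_le e he hω hl hβ.le hγ.le hN hT.le x
  obtain ⟨hec, -, hbd, -⟩ := pinnedChain_splitSite_nice e he hω hl hβ.le x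
  obtain ⟨-, hℓc, hℓb⟩ := pinnedChain_generator_splitSite_nice e he hω hl hβ.le hγ.le hT.le x
  set θ : ℝ := 1 / (2 * T) with hθ
  have hθ0 : 0 < θ := by positivity
  have hθ1 : θ < 1 / T := by rw [hθ, div_lt_div_iff₀ (by positivity) hT]; nlinarith
  set B : ℝ := (N : ℝ) ^ 2 * (3 + β) + (2 * T + 4) * γ with hB
  have hB0 : 0 ≤ B := by positivity
  set C₀ : ℝ := 2 * Real.exp θ / θ ^ 2 with hC₀
  have hC₀0 : 0 ≤ C₀ := by positivity
  set ℓ : PhaseSpace N → ℝ := P.generator N T T (e x) with hℓ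
  set f : ℕ → PhaseSpace N → ℝ := fun n y => e x y * smoothCutoff (P.hamiltonian N y / (n + 1)) with hf
  have hfdef : ∀ n y, f n y = e x y * smoothCutoff (P.hamiltonian N y / (n + 1)) := fun n y => rfl
  -- regularity and compact support
  have hU2 : ContDiff ℝ 2 P.U := pinnedChain_contDiff_U ω₂ lam β γ
  have hV2 : ContDiff ℝ 2 P.V := pinnedChain_contDiff_V ω₂ lam β γ
  have he2 : ContDiff ℝ 2 (e x) := by
    rw [splitSite_eq e he x, splitSiteEnergy_eq_energyProfile _ x]
    refine (ContDiff.sum fun k _ => contDiff_const.mul ?_).add (ContDiff.sum fun k _ => ContDiff.sum fun l _ => ?_)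
    · exact (((contDiff_apply ℝ ℝ k).comp contDiff_snd).pow 2 |>.div_const 2).add
        (hU2.comp ((contDiff_apply ℝ ℝ k).comp contDiff_fst))
    · by_cases hlk : l.val = k.val + 1
      · simp only [hlk, if_true]
        exact contDiff_const.mul (hV2.comp (((contDiff_apply ℝ ℝ l).comp contDiff_fst).sub
          ((contDiff_apply ℝ ℝ k).comp contDiff_fst)))
      · simp only [hlk, if_false]; exact contDiff_const
  have hH2 : ContDiff ℝ 2 (P.hamiltonian N) := P.contDiff_hamiltonian hU2 hV2 N
  have hH0 : ∀ y, 0 ≤ P.hamiltonian N y := fun y => pinnedChain_hamiltonian_nonneg hω.le hl hβ.le γ N y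
  have hRpos : ∀ n : ℕ, (0:ℝ) < n + 1 := fun n => by positivity
  have hR1 : ∀ n : ℕ, (1:ℝ) ≤ n + 1 := fun n => by
    have : (0:ℝ) ≤ n := Nat.cast_nonneg n
    linarith
  have hf2 : ∀ n, ContDiff ℝ 2 (f n) := fun n => he2.mul ((contDiff_smoothCutoff (n := 2)).comp (hH2.div_const _))
  have hfs : ∀ n, HasCompactSupport (f n) := fun n => by
    refine HasCompactSupport.intro (pinnedChain_isCompact_setOf_hamiltonian_le hω hl hβ.le γ N (2 * (n + 1))) fun y hy => ?_
    simp only [mem_setOf_eq, not_le] at hy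
    have h2 : 2 ≤ P.hamiltonian N y / (n + 1) := by rw [le_div_iff₀ (hRpos n)]; linarith
    rw [hfdef, smoothCutoff_of_two_le h2, mul_zero]
  -- eventually the cutoff is `1`
  have hev : ∀ y, ∀ᶠ n : ℕ in atTop, smoothCutoff (P.hamiltonian N y / (n + 1)) = 1 := by
    intro y
    obtain ⟨n₀, hn₀⟩ := exists_nat_ge (P.hamiltonian N y)
    filter_upwards [eventually_ge_atTop n₀] with n hn
    have h1 : P.hamiltonian N y / (n + 1) ≤ 1 := by
      rw [div_le_one (hRpos n)]
      have : (n₀ : ℝ) ≤ n := by exact_mod_cast hn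
      linarith
    exact smoothCutoff_of_le_one h1
  -- size estimates
  have hsq : ∀ y, (1 + P.hamiltonian N y) ^ 2 ≤ C₀ * Real.exp (θ * P.hamiltonian N y) := fun y => one_add_sq_le_exp (hH0 y) hθ0
  have hEle : ∀ y, e x y ≤ ((N : ℝ) + 2) * (1 + P.hamiltonian N y) ^ 2 := fun y => by
    have h1 := (hbd y).2
    have hHy := hH0 y
    nlinarith [sq_nonneg (P.hamiltonian N y), Nat.cast_nonneg (α := ℝ) N]
  -- the truncation error, with `Le = ℓ`
  have herr : ∀ (n : ℕ) (y : PhaseSpace N), |P.generator N T T (f n) y - smoothCutoff (P.hamiltonian N y / (n + 1)) * ℓ y| ≤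
      A / (n + 1) * (1 + P.hamiltonian N y) ^ 2 := fun n y => hA (n + 1) (hR1 n) y
  -- uniform exponential domination
  set K : ℝ := (A + B + (N + 2)) * C₀ with hK
  have hfb : ∀ (n : ℕ) (y : PhaseSpace N), |f n y| ≤ K * Real.exp (θ * P.hamiltonian N y) := by
    intro n y
    obtain ⟨h0, -⟩ := hbd y
    have h1 := hEle y
    have hχ0 := smoothCutoff_nonneg (P.hamiltonian N y / (n + 1))
    have hχ1 := smoothCutoff_le_one (P.hamiltonian N y / (n + 1))
    have hs := hsq y
    rw [hfdef, abs_of_nonneg (mul_nonneg h0 hχ0)]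
    generalize smoothCutoff (P.hamiltonian N y / (n + 1)) = c at hχ0 hχ1 ⊢
    generalize e x y = E at h0 h1 ⊢
    generalize P.hamiltonian N y = Hy at h1 hs ⊢
    calc E * c ≤ E := mul_le_of_le_one_right h0 hχ1
      _ ≤ ((N : ℝ) + 2) * (1 + Hy) ^ 2 := h1
      _ ≤ (A + B + (N + 2)) * (1 + Hy) ^ 2 := mul_le_mul_of_nonneg_right (by linarith) (sq_nonneg _)
      _ ≤ (A + B + (N + 2)) * (C₀ * Real.exp (θ * Hy)) := by gcongr
      _ = K * Real.exp (θ * Hy) := by simp only [hK]; ring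
  have hLb : ∀ (n : ℕ) (y : PhaseSpace N), |P.generator N T T (f n) y| ≤ K * Real.exp (θ * P.hamiltonian N y) := by
    intro n y
    have h1 := herr n y
    have h2 := hℓb y
    have hs := hsq y
    have hHy := hH0 y
    have hχ0 := smoothCutoff_nonneg (P.hamiltonian N y / (n + 1))
    have hχ1 := smoothCutoff_le_one (P.hamiltonian N y / (n + 1))
    generalize P.generator N T T (f n) y = G at h1 ⊢
    simp only [hℓ] at h1 h2
    generalize P.generator N T T (e x) y = l at h1 h2 ⊢
    generalize P.hamiltonian N y = Hy at h1 h2 hs hHy hχ0 hχ1 ⊢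
    generalize smoothCutoff (Hy / (n + 1)) = c at hχ0 hχ1 h1 ⊢
    have h3 : |c * l| ≤ B * (1 + Hy) ^ 2 := by
      rw [abs_mul, abs_of_nonneg hχ0]
      calc c * |l| ≤ 1 * |l| := mul_le_mul_of_nonneg_right hχ1 (abs_nonneg _)
        _ ≤ B * (1 + Hy) ^ 2 := by rw [one_mul]; exact h2
    have h4 : A / (n + 1) * (1 + Hy) ^ 2 ≤ A * (1 + Hy) ^ 2 :=
      mul_le_mul_of_nonneg_right (div_le_self hA0 (hR1 n)) (sq_nonneg _)
    have hN2 : (0 : ℝ) ≤ (N : ℝ) + 2 := by positivity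
    calc |G| ≤ |G - c * l| + |c * l| := by
          have := abs_add_le (G - c * l) (c * l); rwa [sub_add_cancel] at this
      _ ≤ A * (1 + Hy) ^ 2 + B * (1 + Hy) ^ 2 := add_le_add (h1.trans h4) h3
      _ ≤ (A + B + (N + 2)) * (1 + Hy) ^ 2 := by nlinarith [sq_nonneg (1 + Hy)]
      _ ≤ (A + B + (N + 2)) * (C₀ * Real.exp (θ * Hy)) := by gcongr
      _ = K * Real.exp (θ * Hy) := by simp only [hK]; ring
  -- pointwise convergence
  have hfe : ∀ y, Tendsto (fun n => f n y) atTop (𝓝 (e x y)) := fun y => by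
    refine tendsto_const_nhds.congr' ?_
    filter_upwards [hev y] with n hn
    rw [hfdef, hn, mul_one]
  have hfℓ : ∀ y, Tendsto (fun n => P.generator N T T (f n) y) atTop (𝓝 (ℓ y)) := by
    intro y
    have hg : Tendsto (fun n : ℕ => smoothCutoff (P.hamiltonian N y / (n + 1)) * ℓ y) atTop (𝓝 (ℓ y)) := by
      refine tendsto_const_nhds.congr' ?_
      filter_upwards [hev y] with n hn
      rw [hn, one_mul]
    have hd : Tendsto (fun n : ℕ => P.generator N T T (f n) y - smoothCutoff (P.hamiltonian N y / (n + 1)) * ℓ y)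
        atTop (𝓝 0) := by
      have hCn : Tendsto (fun n : ℕ => A / (n + 1) * (1 + P.hamiltonian N y) ^ 2) atTop (𝓝 0) := by
        have h1 : Tendsto (fun n : ℕ => A / ((n : ℝ) + 1)) atTop (𝓝 0) :=
          tendsto_const_nhds.div_atTop (tendsto_natCast_atTop_atTop.atTop_add tendsto_const_nhds)
        simpa using h1.mul_const ((1 + P.hamiltonian N y) ^ 2)
      exact squeeze_zero_norm (fun n => by rw [Real.norm_eq_abs]; exact herr n y) hCn
    have := hd.add hg
    simpa using this
  exact pinnedChain_dynkin_of_truncation hω hl hβ hγ hN0 hT hθ0 hθ1 f hf2 hfs hfe hfℓ hfb hLb r z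

end SplitSiteDynkin

end Summit.AtomisticToContinuum.FouriersLaw.Theorems.HonestZwanzig

end
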